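import Literature.Analysis.FluidPDE.HessianLaplacianLpProofs
import Literature.Analysis.FluidPDE.LocalBiotSavartLog
import Literature.Analysis.FluidPDE.HelmholtzAnnihilator
import Literature.Analysis.FluidPDE.NewtonLocalPotentialCalculus
import Literature.Analysis.Convolution.YoungInequality
import HarnessLib

/-!
# Tsai's annular Liouville theorem (Tsai 2021, Thm 1.1 (a)) — I: the potential-theoretic kit

Analysis/FluidPDE support file (theorems only: no definitions, no named facts) on the discharge
path of the named fact `Literature.Analysis.FluidPDE.Tsai2021_annular_liouville`
(`SteadyLiouvilleCriteria.lean`; T.-P. Tsai, *Liouville type theorems for stationary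
Navier–Stokes equations*, SN Partial Differ. Equ. Appl. 2 (2021), Paper No. 10 =
arXiv:2005.09691, **Theorem 1.1 (a)**: an `H¹_loc` solution of the steady Navier–Stokes system
in `(EuclideanSpace ℝ (Fin 3))` with `liminf_{R→∞} R⁻¹‖u‖^{3−δ}_{L^q(R<|x|<LR)} = 0`, `q = 6(3−δ)/(6−δ)`, vanishes).

The heart of Tsai's proof (§3) is a **pressure-independent** interior estimate for the Stokes
system on annuli (Lemma 3.1 = Šverák–Tsai 2000, Lemma 3.2), obtained in print from interior
`L^q` theory and Bogovskiĭ's operator. The tree proves it instead with the truncated Newtonian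
potential `N = Γ₀ ⋆` of `NewtonLocalPotential.lean` (`Γ₀ = θΓ` cut off at radii `(r₀, r₁)`),
its smoothing remainder `Λ = λ ⋆` and Green's representation at a fixed scale
`f = N[Δf] + Λ[f]` (`eq_newtonNearPotential_laplacian_add`), plus the tree's PROVED
Calderón–Zygmund bound `stein1970_hessian_Lp_bound_holds_fin3` (Stein 1970, III §1.3 Prop. 3).
This first file collects the kit:

* §1 directional-derivative calculus for smooth scalar functions on `(EuclideanSpace ℝ (Fin 3))` (Leibniz rules, moving a
  cut-off through one and two derivatives, `Δ(χw) = χΔw + 2∇χ·∇w + wΔχ`);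
* §2 the operators on `L^p`: Young for `N` and for kernel integrals (N0), the gradient potential
  `N[∂ₐg] = (∂ₐΓ₀) ⋆ g` (N1, Gilbarg–Trudinger Lemma 4.1), the Calderón–Zygmund bound
  `‖N[∂ₐ∂_bg]‖_p ≤ C‖g‖_p` (N2), pointwise Hölder for kernel integrals;
* §3 cut-offs versus `L^p` norms (`‖χg‖_p ≤ M‖g‖_{L^p(K)}`, components and products of components of
  a vector field);
* §4 one constant for the five operator bounds (N0), (N1), (N2), (Λ0), (Λ1)
  (`exists_operator_bounds`);
* §5 the "move" lemmas `‖N[ψ∂ₐ∂_bf]‖_p ≤ 4CM‖f‖_{L^p(K)}`, `‖N[ψ∂ₐf]‖_p ≤ 2CM‖f‖_{L^p(K)}`,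
  `‖Λ[ψ∂ₐf]‖_p ≤ 2CM‖f‖_{L^p(K)}` for a cut-off `ψ` supported in `K` with `|ψ|, ‖Dψ‖, ‖D²ψ‖ ≤ M`;
* §6 subadditivity of `g ↦ ‖N[g]‖_p`, `g ↦ ‖Λ[g]‖_p`.

## References

* T.-P. Tsai, SN Partial Differ. Equ. Appl. 2 (2021), Paper No. 10 (arXiv:2005.09691), §2–§3.
  [Tsai2021]
* E. M. Stein, *Singular integrals and differentiability properties of functions* (1970),
  Ch. III §1.3, Prop. 3. [Stein1971]
* D. Gilbarg, N. S. Trudinger, *Elliptic partial differential equations of second order* (2001),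
  (2.16)–(2.17), Lemma 4.1. [GilbargTrudinger2001]
-/

noncomputable section

open MeasureTheory Set Filter Function Metric InnerProductSpace Topology
open scoped ENNReal NNReal RealInnerProductSpace Laplacian ContDiff Convolution

namespace Literature.Analysis.FluidPDE

namespace Tsai2021

/-! ### §1. Directional-derivative calculus for smooth scalar functions on `(EuclideanSpace ℝ (Fin 3))` -/

section Calculus

variable {f g χ : (EuclideanSpace ℝ (Fin 3)) → ℝ}

/-- Smooth functions stay smooth under directional differentiation. [folklore] -/
theorem contDiff_pd (hf : ContDiff ℝ ∞ f) (a : (EuclideanSpace ℝ (Fin 3))) : ContDiff ℝ ∞ fun x => fderiv ℝ f x a :=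
  (hf.fderiv_right (m := ∞) le_rfl).clm_apply contDiff_const

/-- The Laplacian as the sum of the three pure second partials. [folklore] -/
theorem laplacian_eq_sum_three (hf : ContDiff ℝ 2 f) (x : (EuclideanSpace ℝ (Fin 3))) :
    (Δ f) x = ∑ i : Fin 3, fderiv ℝ (fun y => fderiv ℝ f y ((EuclideanSpace.single (i : Fin 3) (1 : ℝ)))) x ((EuclideanSpace.single (i : Fin 3) (1 : ℝ))) := by
  rw [laplacian_eq_sum_fderiv_fderiv (EuclideanSpace.basisFun (Fin 3) ℝ) hf x]
  simp only [EuclideanSpace.basisFun_apply]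

/-- Leibniz rule for a directional derivative of a product of `C¹` functions. [folklore] -/
theorem pd_mul_apply (hf : ContDiff ℝ 1 f) (hg : ContDiff ℝ 1 g) (x a : (EuclideanSpace ℝ (Fin 3))) :
    fderiv ℝ (fun y => f y * g y) x a = f x * fderiv ℝ g x a + g x * fderiv ℝ f x a := by
  have hfd : DifferentiableAt ℝ f x := hf.differentiable one_ne_zero x
  have hgd : DifferentiableAt ℝ g x := hg.differentiable one_ne_zero x
  rw [fderiv_fun_mul hfd hgd]
  simp only [add_apply, FunLike.coe_smul, Pi.smul_apply, smul_eq_mul]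

/-- `χ ∂ₐf = ∂ₐ(χf) − f ∂ₐχ`. [folklore] -/
theorem mul_pd_eq (hχ : ContDiff ℝ 1 χ) (hf : ContDiff ℝ 1 f) (x a : (EuclideanSpace ℝ (Fin 3))) :
    χ x * fderiv ℝ f x a =
      fderiv ℝ (fun y => χ y * f y) x a - f x * fderiv ℝ χ x a := by
  rw [pd_mul_apply hχ hf]; ring

/-- Second-order Leibniz: `∂ₐ∂_b(χf) = χ∂ₐ∂_bf + ∂ₐχ∂_bf + ∂_bχ∂ₐf + f∂ₐ∂_bχ`. [folklore] -/
theorem pd_pd_mul_apply (hχ : ContDiff ℝ 2 χ) (hf : ContDiff ℝ 2 f) (x a b : (EuclideanSpace ℝ (Fin 3))) :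
    fderiv ℝ (fun y => fderiv ℝ (fun z => χ z * f z) y b) x a =
      χ x * fderiv ℝ (fun y => fderiv ℝ f y b) x a + fderiv ℝ χ x a * fderiv ℝ f x b
        + fderiv ℝ χ x b * fderiv ℝ f x a + f x * fderiv ℝ (fun y => fderiv ℝ χ y b) x a := by
  have hχ1 : ContDiff ℝ 1 χ := hχ.of_le one_le_two
  have hf1 : ContDiff ℝ 1 f := hf.of_le one_le_two
  have hχb : ContDiff ℝ 1 fun y => fderiv ℝ χ y b := (hχ.fderiv_right (m := 1) le_rfl).clm_apply contDiff_const
  have hfb : ContDiff ℝ 1 fun y => fderiv ℝ f y b := (hf.fderiv_right (m := 1) le_rfl).clm_apply contDiff_const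
  have h1 : (fun y => fderiv ℝ (fun z => χ z * f z) y b) =
      fun y => χ y * fderiv ℝ f y b + f y * fderiv ℝ χ y b :=
    funext fun y => pd_mul_apply hχ1 hf1 y b
  rw [h1]
  rw [fderiv_fun_add ((hχ1.mul hfb).differentiable one_ne_zero x) ((hf1.mul hχb).differentiable one_ne_zero x)]
  rw [add_apply, pd_mul_apply hχ1 hfb, pd_mul_apply hf1 hχb]
  ring

/-- **Moving a cut-off through two derivatives**:
`χ ∂ₐ∂_b f = ∂ₐ∂_b(χf) − ∂ₐ(f∂_bχ) − ∂_b(f∂ₐχ) + f∂ₐ∂_bχ`. [folklore] -/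
theorem mul_pd_pd_eq (hχ : ContDiff ℝ 2 χ) (hf : ContDiff ℝ 2 f) (x a b : (EuclideanSpace ℝ (Fin 3))) :
    χ x * fderiv ℝ (fun y => fderiv ℝ f y b) x a =
      fderiv ℝ (fun y => fderiv ℝ (fun z => χ z * f z) y b) x a
        - fderiv ℝ (fun y => f y * fderiv ℝ χ y b) x a
        - fderiv ℝ (fun y => f y * fderiv ℝ χ y a) x b
        + f x * fderiv ℝ (fun y => fderiv ℝ χ y b) x a := by
  have hχ1 : ContDiff ℝ 1 χ := hχ.of_le one_le_two
  have hf1 : ContDiff ℝ 1 f := hf.of_le one_le_two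
  have hχa : ContDiff ℝ 1 fun y => fderiv ℝ χ y a := (hχ.fderiv_right (m := 1) le_rfl).clm_apply contDiff_const
  have hχb : ContDiff ℝ 1 fun y => fderiv ℝ χ y b := (hχ.fderiv_right (m := 1) le_rfl).clm_apply contDiff_const
  rw [pd_pd_mul_apply hχ hf, pd_mul_apply hf1 hχb, pd_mul_apply hf1 hχa,
    fderiv_fderiv_apply_comm hχ x b a]
  ring

/-- **Laplacian of a product**: `Δ(χw) = χΔw + 2Σᵢ∂ᵢχ∂ᵢw + wΔχ`. [folklore] -/
theorem laplacian_mul_eq (hχ : ContDiff ℝ 2 χ) (hf : ContDiff ℝ 2 f) (x : (EuclideanSpace ℝ (Fin 3))) :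
    (Δ (fun y => χ y * f y)) x =
      χ x * (Δ f) x + 2 * ∑ i : Fin 3, fderiv ℝ χ x ((EuclideanSpace.single (i : Fin 3) (1 : ℝ))) * fderiv ℝ f x ((EuclideanSpace.single (i : Fin 3) (1 : ℝ)))
        + f x * (Δ χ) x := by
  rw [laplacian_eq_sum_three (hχ.mul hf), laplacian_eq_sum_three hf, laplacian_eq_sum_three hχ,
    Finset.mul_sum, Finset.mul_sum, Finset.mul_sum, ← Finset.sum_add_distrib,
    ← Finset.sum_add_distrib]
  refine Finset.sum_congr rfl fun i _ => ?_
  rw [pd_pd_mul_apply hχ hf]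
  ring

end Calculus

/-! ### §2. The operators `N = Γ₀ ⋆` and `Λ = λ ⋆` on `L^p`: Young, gradient kernel, Calderón–Zygmund -/

section Operators

variable {r₀ r₁ : ℝ}

/-- `N[g]` is the convolution `Γ₀ ⋆ g`. [folklore] -/
theorem newtonNearPotential_eq_convolution (r₀ r₁ : ℝ) (g : (EuclideanSpace ℝ (Fin 3)) → ℝ) :
    newtonNearPotential r₀ r₁ g = newtonNear r₀ r₁ ⋆[ContinuousLinearMap.lsmul ℝ ℝ, volume] g := by
  funext x
  rw [convolution_lsmul, newtonNearPotential_apply]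
  simp only [smul_eq_mul]

/-- A kernel integral `x ↦ ∫ k(z) g(x − z) dz` is the convolution `k ⋆ g`. [folklore] -/
theorem integral_mul_comp_sub_eq_convolution (k g : (EuclideanSpace ℝ (Fin 3)) → ℝ) :
    (fun x => ∫ z, k z * g (x - z)) = k ⋆[ContinuousLinearMap.lsmul ℝ ℝ, volume] g := by
  funext x
  rw [convolution_lsmul]
  simp only [smul_eq_mul]

/-- **Young for kernel integrals**: `‖∫ k(z) g(· − z) dz‖_p ≤ ‖k‖₁ ‖g‖_p`, `1 ≤ p`. [folklore] -/
theorem eLpNorm_integral_mul_comp_sub_le {k g : (EuclideanSpace ℝ (Fin 3)) → ℝ} (hk : AEStronglyMeasurable k volume)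
    (hg : AEStronglyMeasurable g volume) {p : ℝ≥0∞} (hp : 1 ≤ p) :
    eLpNorm (fun x => ∫ z, k z * g (x - z)) p volume ≤
      (∫⁻ z, ‖k z‖ₑ) * eLpNorm g p volume := by
  rw [integral_mul_comp_sub_eq_convolution]
  exact UnboundedOperators.eLpNorm_convolution_le_lintegral_enorm_mul hk hg hp

/-- **Hölder for kernel integrals, pointwise**: `|∫ k(z) g(x − z) dz| ≤ ‖k‖_q ‖g‖_p` for
conjugate exponents `q⁻¹ + p⁻¹ = 1` (translation invariance of `‖·‖_p`). [folklore] -/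
theorem enorm_integral_mul_comp_sub_le {k g : (EuclideanSpace ℝ (Fin 3)) → ℝ} (hk : AEStronglyMeasurable k volume)
    (hg : AEStronglyMeasurable g volume) {p q : ℝ≥0∞} [ENNReal.HolderTriple q p 1] (x : (EuclideanSpace ℝ (Fin 3))) :
    ‖∫ z, k z * g (x - z)‖ₑ ≤ eLpNorm k q volume * eLpNorm g p volume := by
  have hmp : MeasurePreserving (fun z : (EuclideanSpace ℝ (Fin 3)) => x - z) volume volume :=
    Measure.measurePreserving_sub_left volume x
  have hgx : AEStronglyMeasurable (fun z => g (x - z)) volume := hg.comp_measurePreserving hmp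
  have hgx' : eLpNorm (fun z => g (x - z)) p volume = eLpNorm g p volume :=
    eLpNorm_comp_measurePreserving hg hmp
  calc ‖∫ z, k z * g (x - z)‖ₑ ≤ ∫⁻ z, ‖k z * g (x - z)‖ₑ := enorm_integral_le_lintegral_enorm _
    _ = eLpNorm (k • fun z => g (x - z)) 1 volume := by
        rw [eLpNorm_one_eq_lintegral_enorm]; rfl
    _ ≤ eLpNorm k q volume * eLpNorm (fun z => g (x - z)) p volume :=
        eLpNorm_smul_le_mul_eLpNorm hgx hk
    _ = eLpNorm k q volume * eLpNorm g p volume := by rw [hgx']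

/-- **(N0) Young for the truncated potential**: `‖N[g]‖_p ≤ ‖Γ₀‖₁ ‖g‖_p`, `1 ≤ p`. [folklore] -/
theorem eLpNorm_newtonNearPotential_le (r₀ r₁ : ℝ) {g : (EuclideanSpace ℝ (Fin 3)) → ℝ}
    (hg : AEStronglyMeasurable g volume) {p : ℝ≥0∞} (hp : 1 ≤ p) :
    eLpNorm (newtonNearPotential r₀ r₁ g) p volume ≤
      (∫⁻ z, ‖newtonNear r₀ r₁ z‖ₑ) * eLpNorm g p volume := by
  rw [newtonNearPotential_eq_convolution]
  exact UnboundedOperators.eLpNorm_convolution_le_lintegral_enorm_mul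
    (measurable_newtonNear r₀ r₁).aestronglyMeasurable hg hp

/-- `Γ₀ ∈ L¹`: its `L¹` mass is finite. [folklore] -/
theorem lintegral_enorm_newtonNear_lt_top (h₀ : 0 ≤ r₀) (h₁ : r₀ < r₁) :
    ∫⁻ z, ‖newtonNear r₀ r₁ z‖ₑ < ⊤ :=
  (integrable_newtonNear h₀ h₁).2

/-- `∂ₐΓ₀ ∈ L¹`: its `L¹` mass is finite. [folklore] -/
theorem lintegral_enorm_newtonNearGrad_lt_top (h₀ : 0 < r₀) (h₁ : r₀ < r₁) (a : (EuclideanSpace ℝ (Fin 3))) :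
    ∫⁻ z, ‖newtonNearGrad r₀ r₁ a z‖ₑ < ⊤ :=
  (integrable_newtonNearGrad h₀ h₁ a).2

/-- `λ ∈ L¹`: its `L¹` mass is finite. [folklore] -/
theorem lintegral_enorm_newtonFarLaplacian_lt_top (h₀ : 0 < r₀) (h₁ : r₀ < r₁) :
    ∫⁻ z, ‖newtonFarLaplacian r₀ r₁ z‖ₑ < ⊤ :=
  (integrable_newtonFarLaplacian h₀ h₁).2

/-- **(N1) The first-derivative potential is bounded on `L^p`**: for `g ∈ C¹_c`,
`‖N[∂ₐg]‖_p ≤ ‖∂ₐΓ₀‖₁ ‖g‖_p` (`N[∂ₐg] = ∂ₐN[g] = (∂ₐΓ₀) ⋆ g`, Gilbarg–Trudinger Lemma 4.1,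
then Young). [cite: GilbargTrudinger2001, Lemma 4.1] -/
theorem eLpNorm_newtonNearPotential_pd_le (h₀ : 0 < r₀) (h₁ : r₀ < r₁) {g : (EuclideanSpace ℝ (Fin 3)) → ℝ}
    (hg : ContDiff ℝ 1 g) (hgc : HasCompactSupport g) {p : ℝ≥0∞} (hp : 1 ≤ p) (a : (EuclideanSpace ℝ (Fin 3))) :
    eLpNorm (newtonNearPotential r₀ r₁ fun w => fderiv ℝ g w a) p volume ≤
      (∫⁻ z, ‖newtonNearGrad r₀ r₁ a z‖ₑ) * eLpNorm g p volume := by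
  have hfun : newtonNearPotential r₀ r₁ (fun w => fderiv ℝ g w a) =
      newtonNearGrad r₀ r₁ a ⋆[ContinuousLinearMap.lsmul ℝ ℝ, volume] g := by
    funext x
    rw [← fderiv_newtonNearPotential_apply h₀.le h₁ hg x a,
      fderiv_newtonNearPotential_eq_newtonNearGradPotential h₀ h₁ hg hgc x a,
      newtonNearGradPotential, convolution_lsmul]
    -- change variables `y = x - t`
    have h := integral_sub_left_eq_self
      (fun y => newtonNearGrad r₀ r₁ a (x - y) • g y) volume x
    simp only [sub_sub_cancel] at h
    exact h.symm
  rw [hfun]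
  exact UnboundedOperators.eLpNorm_convolution_le_lintegral_enorm_mul
    (measurable_newtonNearGrad r₀ r₁ a).aestronglyMeasurable hg.continuous.aestronglyMeasurable hp

/-- **(N2) The second-derivative potential is bounded on `L^p`, `1 < p < ∞`** (Calderón–Zygmund;
Stein 1970, III §1.3 Prop. 3, PROVED in the tree as `stein1970_hessian_Lp_bound_holds_fin3`):
there is `C = C(p, r₀, r₁)` with `‖N[∂_b∂ₐ g]‖_p ≤ C ‖g‖_p` for all `g ∈ C²_c` and all
vectors `a, b` of norm `≤ 1`. [cite: Stein1971, Ch. III §1.3 Prop 3] -/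
theorem exists_eLpNorm_newtonNearPotential_pd_pd_le (h₀ : 0 < r₀) (h₁ : r₀ < r₁) {p : ℝ≥0∞}
    (hp : 1 < p) (hp' : p < ⊤) :
    ∃ C : ℝ≥0, ∀ ⦃g : (EuclideanSpace ℝ (Fin 3)) → ℝ⦄, ContDiff ℝ 2 g → HasCompactSupport g →
      ∀ a b : (EuclideanSpace ℝ (Fin 3)), ‖a‖ ≤ 1 → ‖b‖ ≤ 1 →
        eLpNorm (newtonNearPotential r₀ r₁ fun w => fderiv ℝ (fun y => fderiv ℝ g y a) w b)
            p volume ≤ C * eLpNorm g p volume := by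
  obtain ⟨A, hA⟩ := stein1970_hessian_Lp_bound_holds_fin3.hessian_newtonNearPotential hp hp'
  have hfin : (∫⁻ z, ‖newtonFarLaplacian r₀ r₁ z‖ₑ) < ⊤ := (integrable_newtonFarLaplacian h₀ h₁).2
  refine ⟨A * (1 + (∫⁻ z, ‖newtonFarLaplacian r₀ r₁ z‖ₑ).toNNReal), fun g hg hgc a b ha hb => ?_⟩
  have hfun : (newtonNearPotential r₀ r₁ fun w => fderiv ℝ (fun y => fderiv ℝ g y a) w b) =
      fun x => fderiv ℝ (fun y => fderiv ℝ (newtonNearPotential r₀ r₁ g) y a) x b :=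
    funext fun x => (fderiv_fderiv_newtonNearPotential_apply h₀.le h₁ hg x a b).symm
  rw [hfun]
  refine (hA h₀ h₁ hg hgc a b ha hb).trans_eq ?_
  rw [ENNReal.coe_mul, ENNReal.coe_add, ENNReal.coe_one, ENNReal.coe_toNNReal hfin.ne, mul_assoc]

/-- Moving a derivative from the density onto a `C¹_c` kernel:
`∫ k(z) ∂ₐg(x − z) dz = ∫ ∂ₐk(z) g(x − z) dz` (tree's `integral_fderiv_mul_comp_sub`). [folklore] -/
theorem integral_mul_pd_comp_sub (k : (EuclideanSpace ℝ (Fin 3)) → ℝ) (hk : ContDiff ℝ 1 k) (hkc : HasCompactSupport k)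
    {g : (EuclideanSpace ℝ (Fin 3)) → ℝ} (hg : ContDiff ℝ 1 g) (x a : (EuclideanSpace ℝ (Fin 3))) :
    ∫ z, k z * fderiv ℝ g (x - z) a = ∫ z, fderiv ℝ k z a * g (x - z) :=
  (integral_fderiv_mul_comp_sub hk hkc hg x a).symm

/-- `Λ[∂ₐg](x) = ∫ ∂ₐλ(z) g(x − z) dz` for `g ∈ C¹`. [folklore] -/
theorem newtonFarSmoothing_pd_eq (h₀ : 0 < r₀) (h₁ : r₀ < r₁) {g : (EuclideanSpace ℝ (Fin 3)) → ℝ} (hg : ContDiff ℝ 1 g)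
    (x a : (EuclideanSpace ℝ (Fin 3))) :
    newtonFarSmoothing r₀ r₁ (fun w => fderiv ℝ g w a) x =
      ∫ z, fderiv ℝ (newtonFarLaplacian r₀ r₁) z a * g (x - z) := by
  rw [newtonFarSmoothing_apply]
  exact integral_mul_pd_comp_sub _ (contDiff_newtonFarLaplacian h₀ h₁)
    (hasCompactSupport_newtonFarLaplacian h₀.le h₁) hg x a

end Operators

/-! ### §3. Cut-offs and `L^p` norms -/

section Cutoff

variable {χ : (EuclideanSpace ℝ (Fin 3)) → ℝ} {K : Set (EuclideanSpace ℝ (Fin 3))}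

/-- If `|χ| ≤ M` and `χ` vanishes off the measurable set `K`, then
`‖χ g‖_{L^p((EuclideanSpace ℝ (Fin 3)))} ≤ M ‖g‖_{L^p(K)}`. [folklore] -/
theorem eLpNorm_mul_le_of_abs_le_of_support (hK : MeasurableSet K) {M : ℝ} (hM : ∀ x, |χ x| ≤ M)
    (hsupp : ∀ x, x ∉ K → χ x = 0) (g : (EuclideanSpace ℝ (Fin 3)) → ℝ) (p : ℝ≥0∞) :
    eLpNorm (fun x => χ x * g x) p volume ≤ ENNReal.ofReal M * eLpNorm g p (volume.restrict K) := by
  have hM0 : 0 ≤ M := (abs_nonneg _).trans (hM 0)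
  have hind : (fun x => χ x * g x) = K.indicator fun x => χ x * g x := by
    funext x
    by_cases hx : x ∈ K
    · rw [indicator_of_mem hx]
    · rw [indicator_of_notMem hx, hsupp x hx, zero_mul]
  rw [hind, eLpNorm_indicator_eq_eLpNorm_restrict hK]
  calc eLpNorm (fun x => χ x * g x) p (volume.restrict K)
      ≤ eLpNorm (M • g) p (volume.restrict K) := by
        refine eLpNorm_mono fun x => ?_
        rw [Pi.smul_apply, smul_eq_mul, norm_mul, norm_mul, Real.norm_of_nonneg hM0]
        exact mul_le_mul_of_nonneg_right (hM x) (norm_nonneg _)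
    _ = ENNReal.ofReal M * eLpNorm g p (volume.restrict K) := by
        rw [eLpNorm_const_smul, Real.enorm_eq_ofReal hM0]

/-- A component of a vector field is dominated in `L^p` by the field. [folklore] -/
theorem eLpNorm_apply_le (U : (EuclideanSpace ℝ (Fin 3)) → (EuclideanSpace ℝ (Fin 3))) (i : Fin 3) (p : ℝ≥0∞) (μ : Measure (EuclideanSpace ℝ (Fin 3))) :
    eLpNorm (fun x => U x i) p μ ≤ eLpNorm U p μ :=
  eLpNorm_mono fun x => by simpa using PiLp.norm_apply_le (U x) i

/-- A product of two components is dominated in `L^p` by the square of the `L^{2p}` norm of the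
field: `‖UᵢUⱼ‖_p ≤ ‖U‖²_{2p}`. [folklore] -/
theorem eLpNorm_apply_mul_apply_le (U : (EuclideanSpace ℝ (Fin 3)) → (EuclideanSpace ℝ (Fin 3))) (i j : Fin 3) (p : ℝ≥0∞) (μ : Measure (EuclideanSpace ℝ (Fin 3))) :
    eLpNorm (fun x => U x i * U x j) p μ ≤ eLpNorm U (2 * p) μ ^ (2 : ℝ) := by
  have h2 : eLpNorm (fun x => ‖U x‖ ^ (2 : ℝ)) p μ = eLpNorm U (p * ENNReal.ofReal 2) μ ^ (2 : ℝ) :=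
    eLpNorm_norm_rpow U zero_lt_two
  have hp2 : p * ENNReal.ofReal 2 = 2 * p := by rw [ENNReal.ofReal_ofNat, mul_comm]
  rw [hp2] at h2
  rw [← h2]
  refine eLpNorm_mono_real fun x => ?_
  rw [norm_mul, Real.rpow_two, sq]
  exact mul_le_mul (by simpa using PiLp.norm_apply_le (U x) i)
    (by simpa using PiLp.norm_apply_le (U x) j) (norm_nonneg _) (norm_nonneg _)

end Cutoff

/-! ### §4. One constant for all five operator bounds; moving cut-offs through `N` and `Λ` -/

section Package

variable {r₀ r₁ : ℝ}

/-- A uniform `L¹` bound for the gradient kernels `∂_cΓ₀`, `‖c‖ ≤ 1`. [folklore] -/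
theorem exists_lintegral_enorm_newtonNearGrad_le (h₀ : 0 < r₀) (h₁ : r₀ < r₁) :
    ∃ I : ℝ≥0∞, I < ⊤ ∧ ∀ c : (EuclideanSpace ℝ (Fin 3)), ‖c‖ ≤ 1 → ∫⁻ z, ‖newtonNearGrad r₀ r₁ c z‖ₑ ≤ I := by
  obtain ⟨C, hC0, hC⟩ := exists_abs_newtonNearGrad_le h₀ h₁
  have hs : (2 : ℝ) < 3 := by norm_num
  have h0 : IntegrableOn (fun z : (EuclideanSpace ℝ (Fin 3)) => C * ‖z‖ ^ (-(2 : ℝ))) (ball 0 (r₁ + 1)) :=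
    (NewtonPotentialHolder.integrableOn_ball_norm_rpow_neg hs (r₁ + 1)).const_mul C
  have hmaj : Integrable ((ball (0 : (EuclideanSpace ℝ (Fin 3))) (r₁ + 1)).indicator fun z => C * ‖z‖ ^ (-(2 : ℝ))) :=
    h0.integrable_indicator measurableSet_ball
  refine ⟨∫⁻ z, ‖(ball (0 : (EuclideanSpace ℝ (Fin 3))) (r₁ + 1)).indicator (fun z => C * ‖z‖ ^ (-(2 : ℝ))) z‖ₑ, hmaj.2,
    fun c hc => lintegral_mono fun z => ?_⟩
  rw [← ofReal_norm, ← ofReal_norm, Real.norm_eq_abs]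
  refine ENNReal.ofReal_le_ofReal ?_
  by_cases hz : z ∈ ball (0 : (EuclideanSpace ℝ (Fin 3))) (r₁ + 1)
  · rw [indicator_of_mem hz, Real.norm_of_nonneg (by positivity)]
    calc |newtonNearGrad r₀ r₁ c z| ≤ C * ‖c‖ * ‖z‖ ^ (-(2 : ℝ)) := hC c z
      _ ≤ C * 1 * ‖z‖ ^ (-(2 : ℝ)) := by gcongr
      _ = C * ‖z‖ ^ (-(2 : ℝ)) := by rw [mul_one]
  · rw [indicator_of_notMem hz, norm_zero, newtonNearGrad_eq_zero_of_lt h₀.le h₁ c ?_, abs_zero]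
    rw [mem_ball_zero_iff, not_lt] at hz
    linarith

/-- A uniform `L¹` bound for the kernels `∂_cλ`, `‖c‖ ≤ 1`. [folklore] -/
theorem exists_lintegral_enorm_fderiv_newtonFarLaplacian_le (h₀ : 0 < r₀) (h₁ : r₀ < r₁) :
    ∃ I : ℝ≥0∞, I < ⊤ ∧ ∀ c : (EuclideanSpace ℝ (Fin 3)), ‖c‖ ≤ 1 →
      ∫⁻ z, ‖fderiv ℝ (newtonFarLaplacian r₀ r₁) z c‖ₑ ≤ I := by
  have hk : ContDiff ℝ 1 (newtonFarLaplacian r₀ r₁) := contDiff_newtonFarLaplacian h₀ h₁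
  have hcont : Continuous (fderiv ℝ (newtonFarLaplacian r₀ r₁)) := hk.continuous_fderiv one_ne_zero
  have hcs : HasCompactSupport (fderiv ℝ (newtonFarLaplacian r₀ r₁)) :=
    (hasCompactSupport_newtonFarLaplacian h₀.le h₁).fderiv (𝕜 := ℝ)
  have hint : Integrable (fderiv ℝ (newtonFarLaplacian r₀ r₁)) := hcont.integrable_of_hasCompactSupport hcs
  refine ⟨∫⁻ z, ‖fderiv ℝ (newtonFarLaplacian r₀ r₁) z‖ₑ, hint.2, fun c hc => lintegral_mono fun z => ?_⟩
  rw [← ofReal_norm, ← ofReal_norm]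
  refine ENNReal.ofReal_le_ofReal ?_
  calc ‖fderiv ℝ (newtonFarLaplacian r₀ r₁) z c‖ ≤ ‖fderiv ℝ (newtonFarLaplacian r₀ r₁) z‖ * ‖c‖ :=
        ContinuousLinearMap.le_opNorm _ _
    _ ≤ ‖fderiv ℝ (newtonFarLaplacian r₀ r₁) z‖ * 1 := by gcongr
    _ = ‖fderiv ℝ (newtonFarLaplacian r₀ r₁) z‖ := mul_one _

/-- **One constant for all the operator bounds on `L^p`, `1 < p < ∞`.** There is
`C = C(p, r₀, r₁)` such that, for densities `g`:
(N0) `‖N[g]‖_p ≤ C‖g‖_p`; (N1) `‖N[∂_c g]‖_p ≤ C‖g‖_p` (`g ∈ C¹_c`, `‖c‖ ≤ 1`);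
(N2) `‖N[∂_b∂ₐ g]‖_p ≤ C‖g‖_p` (`g ∈ C²_c`, `‖a‖, ‖b‖ ≤ 1`; Calderón–Zygmund);
(Λ0) `‖Λ[g]‖_p ≤ C‖g‖_p`; (Λ1) `‖∫ ∂_cλ(z) g(· − z) dz‖_p ≤ C‖g‖_p` (`‖c‖ ≤ 1`).
[cite: Stein1971, Ch. III §1.3 Prop 3] -/
theorem exists_operator_bounds (h₀ : 0 < r₀) (h₁ : r₀ < r₁) {p : ℝ≥0∞} (hp : 1 < p) (hp' : p < ⊤) :
    ∃ C : ℝ≥0,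
      (∀ g : (EuclideanSpace ℝ (Fin 3)) → ℝ, AEStronglyMeasurable g volume →
          eLpNorm (newtonNearPotential r₀ r₁ g) p volume ≤ C * eLpNorm g p volume) ∧
      (∀ g : (EuclideanSpace ℝ (Fin 3)) → ℝ, ContDiff ℝ 1 g → HasCompactSupport g → ∀ c : (EuclideanSpace ℝ (Fin 3)), ‖c‖ ≤ 1 →
          eLpNorm (newtonNearPotential r₀ r₁ fun w => fderiv ℝ g w c) p volume ≤
            C * eLpNorm g p volume) ∧
      (∀ g : (EuclideanSpace ℝ (Fin 3)) → ℝ, ContDiff ℝ 2 g → HasCompactSupport g → ∀ a b : (EuclideanSpace ℝ (Fin 3)), ‖a‖ ≤ 1 → ‖b‖ ≤ 1 →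
          eLpNorm (newtonNearPotential r₀ r₁ fun w => fderiv ℝ (fun y => fderiv ℝ g y a) w b)
            p volume ≤ C * eLpNorm g p volume) ∧
      (∀ g : (EuclideanSpace ℝ (Fin 3)) → ℝ, AEStronglyMeasurable g volume →
          eLpNorm (newtonFarSmoothing r₀ r₁ g) p volume ≤ C * eLpNorm g p volume) ∧
      (∀ g : (EuclideanSpace ℝ (Fin 3)) → ℝ, AEStronglyMeasurable g volume → ∀ c : (EuclideanSpace ℝ (Fin 3)), ‖c‖ ≤ 1 →
          eLpNorm (fun x => ∫ z, fderiv ℝ (newtonFarLaplacian r₀ r₁) z c * g (x - z)) p volume ≤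
            C * eLpNorm g p volume) := by
  have hp1 : 1 ≤ p := hp.le
  obtain ⟨I₁, hI₁, hI₁b⟩ := exists_lintegral_enorm_newtonNearGrad_le h₀ h₁
  obtain ⟨I₂, hI₂, hI₂b⟩ := exists_lintegral_enorm_fderiv_newtonFarLaplacian_le h₀ h₁
  obtain ⟨C₂, hC₂⟩ := exists_eLpNorm_newtonNearPotential_pd_pd_le h₀ h₁ hp hp'
  have hI₀ : (∫⁻ z, ‖newtonNear r₀ r₁ z‖ₑ) < ⊤ := lintegral_enorm_newtonNear_lt_top h₀.le h₁
  have hI₃ : (∫⁻ z, ‖newtonFarLaplacian r₀ r₁ z‖ₑ) < ⊤ := lintegral_enorm_newtonFarLaplacian_lt_top h₀ h₁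
  -- one constant dominating all five
  set S : ℝ≥0∞ := (∫⁻ z, ‖newtonNear r₀ r₁ z‖ₑ) + I₁ + C₂ +
    (∫⁻ z, ‖newtonFarLaplacian r₀ r₁ z‖ₑ) + I₂ with hSdef
  have hS : S ≠ ⊤ := ENNReal.add_ne_top.2 ⟨ENNReal.add_ne_top.2 ⟨ENNReal.add_ne_top.2
    ⟨ENNReal.add_ne_top.2 ⟨hI₀.ne, hI₁.ne⟩, ENNReal.coe_ne_top⟩, hI₃.ne⟩, hI₂.ne⟩
  set C : ℝ≥0 := S.toNNReal with hCdef
  have hCS : (C : ℝ≥0∞) = S := ENNReal.coe_toNNReal hS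
  have e0 : (∫⁻ z, ‖newtonNear r₀ r₁ z‖ₑ) ≤ C := by
    rw [hCS, hSdef]
    calc (∫⁻ z, ‖newtonNear r₀ r₁ z‖ₑ)
        ≤ (∫⁻ z, ‖newtonNear r₀ r₁ z‖ₑ) + (I₁ + C₂ + (∫⁻ z, ‖newtonFarLaplacian r₀ r₁ z‖ₑ) + I₂) :=
          le_self_add
      _ = _ := by simp only [add_assoc]
  have e1 : I₁ ≤ C := by
    rw [hCS, hSdef]
    calc I₁ ≤ ((∫⁻ z, ‖newtonNear r₀ r₁ z‖ₑ) + I₁) + (C₂ + (∫⁻ z, ‖newtonFarLaplacian r₀ r₁ z‖ₑ) + I₂) :=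
          le_add_self.trans le_self_add
      _ = _ := by simp only [add_assoc]
  have e2 : (C₂ : ℝ≥0∞) ≤ C := by
    rw [hCS, hSdef]
    calc (C₂ : ℝ≥0∞) ≤ ((∫⁻ z, ‖newtonNear r₀ r₁ z‖ₑ) + I₁ + C₂) +
        ((∫⁻ z, ‖newtonFarLaplacian r₀ r₁ z‖ₑ) + I₂) := le_add_self.trans le_self_add
      _ = _ := by simp only [add_assoc]
  have e3 : (∫⁻ z, ‖newtonFarLaplacian r₀ r₁ z‖ₑ) ≤ C := by
    rw [hCS, hSdef]
    exact le_add_self.trans le_self_add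
  have e4 : I₂ ≤ C := by
    rw [hCS, hSdef]
    exact le_add_self
  refine ⟨C, fun g hg => ?_, fun g hg hgc c hc => ?_, fun g hg hgc a b ha hb => ?_,
    fun g hg => ?_, fun g hg c hc => ?_⟩
  · exact (eLpNorm_newtonNearPotential_le r₀ r₁ hg hp1).trans (mul_le_mul' e0 le_rfl)
  · exact (eLpNorm_newtonNearPotential_pd_le h₀ h₁ hg hgc hp1 c).trans
      (mul_le_mul' ((hI₁b c hc).trans e1) le_rfl)
  · exact (hC₂ hg hgc a b ha hb).trans (mul_le_mul' e2 le_rfl)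
  · rw [newtonFarSmoothing_eq_convolution]
    exact (UnboundedOperators.eLpNorm_convolution_le_lintegral_enorm_mul
      (continuous_newtonFarLaplacian h₀ h₁).aestronglyMeasurable hg hp1).trans
      (mul_le_mul' e3 le_rfl)
  · have hk : AEStronglyMeasurable (fun z => fderiv ℝ (newtonFarLaplacian r₀ r₁) z c) volume :=
      (((contDiff_newtonFarLaplacian h₀ h₁).continuous_fderiv one_ne_zero).clm_apply
        continuous_const).aestronglyMeasurable
    exact (eLpNorm_integral_mul_comp_sub_le hk hg hp1).trans
      (mul_le_mul' ((hI₂b c hc).trans e4) le_rfl)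

end Package

/-! ### §5. Cut-off data and the "move" lemmas -/

section Move

variable {r₀ r₁ : ℝ} {p : ℝ≥0∞} {C : ℝ≥0} {ψ f : (EuclideanSpace ℝ (Fin 3)) → ℝ} {K : Set (EuclideanSpace ℝ (Fin 3))} {M : ℝ}

/-- A `C²` function with compact support is bounded together with its first two derivatives
(operator norms). [folklore] -/
theorem exists_bound_two (hψ : ContDiff ℝ 2 ψ) (hψc : HasCompactSupport ψ) :
    ∃ M : ℝ, 0 ≤ M ∧ (∀ x, |ψ x| ≤ M) ∧ (∀ x, ‖fderiv ℝ ψ x‖ ≤ M) ∧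
      (∀ x, ‖fderiv ℝ (fderiv ℝ ψ) x‖ ≤ M) := by
  have hψ1 : ContDiff ℝ 1 ψ := hψ.of_le one_le_two
  obtain ⟨M₀, hM₀⟩ := hψ.continuous.bounded_above_of_compact_support hψc
  obtain ⟨M₁, hM₁⟩ := (hψ1.continuous_fderiv one_ne_zero).bounded_above_of_compact_support
    (hψc.fderiv (𝕜 := ℝ))
  obtain ⟨M₂, hM₂⟩ := ((hψ.fderiv_right (m := 1) le_rfl).continuous_fderiv
    one_ne_zero).bounded_above_of_compact_support ((hψc.fderiv (𝕜 := ℝ)).fderiv (𝕜 := ℝ))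
  refine ⟨max (max M₀ M₁) (max M₂ 0), le_max_of_le_right (le_max_right _ _), fun x => ?_,
    fun x => ?_, fun x => ?_⟩
  · rw [← Real.norm_eq_abs]
    exact (hM₀ x).trans (le_max_of_le_left (le_max_left _ _))
  · exact (hM₁ x).trans (le_max_of_le_left (le_max_right _ _))
  · exact (hM₂ x).trans (le_max_of_le_right (le_max_left _ _))

/-- Directional derivatives vanish off the topological support. [folklore] -/
theorem pd_eq_zero_of_notMem_tsupport {x : (EuclideanSpace ℝ (Fin 3))} (hx : x ∉ tsupport ψ) (a : (EuclideanSpace ℝ (Fin 3))) :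
    fderiv ℝ ψ x a = 0 := by
  rw [fderiv_of_notMem_tsupport ℝ hx]; rfl

/-- The topological support of a directional derivative lies in that of the function. [folklore] -/
theorem tsupport_pd_subset (ψ : (EuclideanSpace ℝ (Fin 3)) → ℝ) (a : (EuclideanSpace ℝ (Fin 3))) :
    tsupport (fun x => fderiv ℝ ψ x a) ⊆ tsupport ψ :=
  tsupport_fderiv_apply_subset ℝ a

/-- Second directional derivatives vanish off the topological support. [folklore] -/
theorem pd_pd_eq_zero_of_notMem_tsupport {x : (EuclideanSpace ℝ (Fin 3))} (hx : x ∉ tsupport ψ) (a b : (EuclideanSpace ℝ (Fin 3))) :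
    fderiv ℝ (fun y => fderiv ℝ ψ y b) x a = 0 :=
  pd_eq_zero_of_notMem_tsupport (fun h => hx (tsupport_pd_subset ψ b h)) a

/-- The topological support of the Laplacian lies in that of the function. [folklore] -/
theorem tsupport_laplacian_subset (ψ : (EuclideanSpace ℝ (Fin 3)) → ℝ) : tsupport (Δ ψ) ⊆ tsupport ψ := by
  refine closure_minimal (fun x hx => ?_) (isClosed_tsupport ψ)
  by_contra h
  exact hx (laplacian_eq_zero_of_notMem_tsupport h)

/-- A directional derivative of a compactly supported function has compact support. [folklore] -/
theorem hasCompactSupport_pd (hψc : HasCompactSupport ψ) (a : (EuclideanSpace ℝ (Fin 3))) :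
    HasCompactSupport fun x => fderiv ℝ ψ x a :=
  hψc.fderiv_apply (𝕜 := ℝ) a

/-- The Laplacian of a compactly supported function has compact support. [folklore] -/
theorem hasCompactSupport_laplacian (hψc : HasCompactSupport ψ) : HasCompactSupport (Δ ψ) :=
  HasCompactSupport.intro hψc fun _ hx => laplacian_eq_zero_of_notMem_tsupport hx

/-- `|∂ₐψ| ≤ M` when `‖Dψ‖ ≤ M` and `‖a‖ ≤ 1`. [folklore] -/
theorem abs_pd_le (hM1 : ∀ x, ‖fderiv ℝ ψ x‖ ≤ M) {a : (EuclideanSpace ℝ (Fin 3))} (ha : ‖a‖ ≤ 1) (x : (EuclideanSpace ℝ (Fin 3))) :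
    |fderiv ℝ ψ x a| ≤ M := by
  have hM : 0 ≤ M := (norm_nonneg _).trans (hM1 x)
  rw [← Real.norm_eq_abs]
  calc ‖fderiv ℝ ψ x a‖ ≤ ‖fderiv ℝ ψ x‖ * ‖a‖ := ContinuousLinearMap.le_opNorm _ _
    _ ≤ M * 1 := mul_le_mul (hM1 x) ha (norm_nonneg _) hM
    _ = M := mul_one M

/-- `|∂ₐ∂_bψ| ≤ M` when `‖D²ψ‖ ≤ M` and `‖a‖, ‖b‖ ≤ 1`. [folklore] -/
theorem abs_pd_pd_le (hψ : ContDiff ℝ 2 ψ) (hM2 : ∀ x, ‖fderiv ℝ (fderiv ℝ ψ) x‖ ≤ M) {a b : (EuclideanSpace ℝ (Fin 3))}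
    (ha : ‖a‖ ≤ 1) (hb : ‖b‖ ≤ 1) (x : (EuclideanSpace ℝ (Fin 3))) :
    |fderiv ℝ (fun y => fderiv ℝ ψ y b) x a| ≤ M := by
  have hM : 0 ≤ M := le_trans (norm_nonneg (fderiv ℝ (fderiv ℝ ψ) x)) (hM2 x)
  have hd : DifferentiableAt ℝ (fderiv ℝ ψ) x :=
    ((hψ.fderiv_right (m := 1) le_rfl).differentiable one_ne_zero) x
  rw [fderiv_apply_const_apply hd, ← Real.norm_eq_abs]
  calc ‖fderiv ℝ (fderiv ℝ ψ) x a b‖ ≤ ‖fderiv ℝ (fderiv ℝ ψ) x a‖ * ‖b‖ :=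
        ContinuousLinearMap.le_opNorm _ _
    _ ≤ ‖fderiv ℝ (fderiv ℝ ψ) x‖ * ‖a‖ * ‖b‖ := by
        gcongr; exact ContinuousLinearMap.le_opNorm _ _
    _ ≤ M * 1 * 1 := by gcongr; exact hM2 x
    _ = M := by ring

/-- **(M0) `‖N[ψf]‖_p ≤ C M ‖f‖_{L^p(K)}`** for a cut-off `ψ` with `|ψ| ≤ M` supported in `K`.
[folklore] -/
theorem eLpNorm_newtonNearPotential_mul_le
    (hN0 : ∀ g : (EuclideanSpace ℝ (Fin 3)) → ℝ, AEStronglyMeasurable g volume →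
      eLpNorm (newtonNearPotential r₀ r₁ g) p volume ≤ C * eLpNorm g p volume)
    (hK : MeasurableSet K) (hψK : tsupport ψ ⊆ K) (hM0 : ∀ x, |ψ x| ≤ M)
    (hψm : Continuous ψ) (hf : Continuous f) :
    eLpNorm (newtonNearPotential r₀ r₁ fun x => ψ x * f x) p volume ≤
      C * ENNReal.ofReal M * eLpNorm f p (volume.restrict K) := by
  refine (hN0 _ (hψm.mul hf).aestronglyMeasurable).trans ?_
  rw [mul_assoc]
  gcongr
  exact eLpNorm_mul_le_of_abs_le_of_support hK hM0
    (fun x hx => image_eq_zero_of_notMem_tsupport fun h => hx (hψK h)) f p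

/-- **(M1) `‖N[ψ ∂ₐf]‖_p ≤ 2 C M ‖f‖_{L^p(K)}`** (`ψ∂ₐf = ∂ₐ(ψf) − f∂ₐψ`). [folklore] -/
theorem eLpNorm_newtonNearPotential_mul_pd_le (h₀ : 0 < r₀) (h₁ : r₀ < r₁) (hp : 1 ≤ p)
    (hN0 : ∀ g : (EuclideanSpace ℝ (Fin 3)) → ℝ, AEStronglyMeasurable g volume →
      eLpNorm (newtonNearPotential r₀ r₁ g) p volume ≤ C * eLpNorm g p volume)
    (hN1 : ∀ g : (EuclideanSpace ℝ (Fin 3)) → ℝ, ContDiff ℝ 1 g → HasCompactSupport g → ∀ c : (EuclideanSpace ℝ (Fin 3)), ‖c‖ ≤ 1 →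
      eLpNorm (newtonNearPotential r₀ r₁ fun w => fderiv ℝ g w c) p volume ≤ C * eLpNorm g p volume)
    (hψ : ContDiff ℝ ∞ ψ) (hψc : HasCompactSupport ψ) (hK : MeasurableSet K) (hψK : tsupport ψ ⊆ K)
    (hM0 : ∀ x, |ψ x| ≤ M) (hM1 : ∀ x, ‖fderiv ℝ ψ x‖ ≤ M) (hf : ContDiff ℝ ∞ f)
    {a : (EuclideanSpace ℝ (Fin 3))} (ha : ‖a‖ ≤ 1) :
    eLpNorm (newtonNearPotential r₀ r₁ fun x => ψ x * fderiv ℝ f x a) p volume ≤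
      2 * (C * ENNReal.ofReal M * eLpNorm f p (volume.restrict K)) := by
  have hψ1 : ContDiff ℝ 1 ψ := hψ.of_le (by norm_cast)
  have hf1 : ContDiff ℝ 1 f := hf.of_le (by norm_cast)
  have hψa : ContDiff ℝ ∞ fun y => fderiv ℝ ψ y a := contDiff_pd hψ a
  have hfa : ContDiff ℝ ∞ fun y => fderiv ℝ f y a := contDiff_pd hf a
  -- the two pieces
  set G1 : (EuclideanSpace ℝ (Fin 3)) → ℝ := fun x => fderiv ℝ (fun y => ψ y * f y) x a with hG1
  set G2 : (EuclideanSpace ℝ (Fin 3)) → ℝ := fun x => f x * fderiv ℝ ψ x a with hG2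
  have hG1c : Continuous G1 := (contDiff_pd (hψ.mul hf) a).continuous
  have hG2c : Continuous G2 := (hf.continuous).mul hψa.continuous
  have hsplit : (fun x => ψ x * fderiv ℝ f x a) = fun x => G1 x + (-1) * G2 x := by
    funext x; rw [mul_pd_eq hψ1 hf1 x a]; ring
  have hlin : newtonNearPotential r₀ r₁ (fun x => ψ x * fderiv ℝ f x a) =
      fun x => newtonNearPotential r₀ r₁ G1 x + (-1) * newtonNearPotential r₀ r₁ G2 x := by
    funext x
    have hc2 : Continuous fun x => (-1 : ℝ) * G2 x := continuous_const.mul hG2c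
    rw [hsplit, show (fun x => G1 x + (-1) * G2 x) = G1 + fun x => (-1) * G2 x from rfl,
      newtonNearPotential_add h₀.le h₁ hG1c hc2, newtonNearPotential_const_mul]
  rw [hlin]
  have hm1 : AEStronglyMeasurable (newtonNearPotential r₀ r₁ G1) volume :=
    (contDiff_newtonNearPotential h₀.le h₁ 0 (contDiff_zero.2 hG1c)).continuous.aestronglyMeasurable
  have hm2 : AEStronglyMeasurable (fun x => (-1 : ℝ) * newtonNearPotential r₀ r₁ G2 x) volume :=
    (continuous_const.mul (contDiff_newtonNearPotential h₀.le h₁ 0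
      (contDiff_zero.2 hG2c)).continuous).aestronglyMeasurable
  refine (eLpNorm_add_le hm1 hm2 hp).trans ?_
  rw [two_mul]
  refine add_le_add ?_ ?_
  · -- `N[∂ₐ(ψf)]`
    refine (hN1 _ ((hψ.mul hf).of_le (by norm_cast)) (hψc.mul_right) a ha).trans ?_
    rw [mul_assoc]
    gcongr
    exact eLpNorm_mul_le_of_abs_le_of_support hK hM0
      (fun x hx => image_eq_zero_of_notMem_tsupport fun h => hx (hψK h)) f p
  · -- `N[f ∂ₐψ]`
    have e : (fun x => (-1 : ℝ) * newtonNearPotential r₀ r₁ G2 x) =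
        (-1 : ℝ) • newtonNearPotential r₀ r₁ G2 := rfl
    rw [e, eLpNorm_const_smul]
    simp only [enorm_neg, enorm_one, one_mul]
    have hG2' : G2 = fun x => fderiv ℝ ψ x a * f x := by funext x; rw [hG2]; ring
    rw [hG2']
    refine (hN0 _ (hψa.continuous.mul hf.continuous).aestronglyMeasurable).trans ?_
    rw [mul_assoc]
    gcongr
    exact eLpNorm_mul_le_of_abs_le_of_support hK (abs_pd_le hM1 ha)
      (fun x hx => pd_eq_zero_of_notMem_tsupport (fun h => hx (hψK h)) a) f p

/-- **(M2) `‖N[ψ ∂ₐ∂_bf]‖_p ≤ 4 C M ‖f‖_{L^p(K)}`**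
(`ψ∂ₐ∂_bf = ∂ₐ∂_b(ψf) − ∂ₐ(f∂_bψ) − ∂_b(f∂ₐψ) + f∂ₐ∂_bψ`; Calderón–Zygmund on the first term).
[folklore] -/
theorem eLpNorm_newtonNearPotential_mul_pd_pd_le (h₀ : 0 < r₀) (h₁ : r₀ < r₁) (hp : 1 ≤ p)
    (hN0 : ∀ g : (EuclideanSpace ℝ (Fin 3)) → ℝ, AEStronglyMeasurable g volume →
      eLpNorm (newtonNearPotential r₀ r₁ g) p volume ≤ C * eLpNorm g p volume)
    (hN1 : ∀ g : (EuclideanSpace ℝ (Fin 3)) → ℝ, ContDiff ℝ 1 g → HasCompactSupport g → ∀ c : (EuclideanSpace ℝ (Fin 3)), ‖c‖ ≤ 1 →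
      eLpNorm (newtonNearPotential r₀ r₁ fun w => fderiv ℝ g w c) p volume ≤ C * eLpNorm g p volume)
    (hN2 : ∀ g : (EuclideanSpace ℝ (Fin 3)) → ℝ, ContDiff ℝ 2 g → HasCompactSupport g → ∀ a b : (EuclideanSpace ℝ (Fin 3)), ‖a‖ ≤ 1 → ‖b‖ ≤ 1 →
      eLpNorm (newtonNearPotential r₀ r₁ fun w => fderiv ℝ (fun y => fderiv ℝ g y a) w b)
        p volume ≤ C * eLpNorm g p volume)
    (hψ : ContDiff ℝ ∞ ψ) (hψc : HasCompactSupport ψ) (hK : MeasurableSet K) (hψK : tsupport ψ ⊆ K)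
    (hM0 : ∀ x, |ψ x| ≤ M) (hM1 : ∀ x, ‖fderiv ℝ ψ x‖ ≤ M)
    (hM2 : ∀ x, ‖fderiv ℝ (fderiv ℝ ψ) x‖ ≤ M) (hf : ContDiff ℝ ∞ f)
    {a b : (EuclideanSpace ℝ (Fin 3))} (ha : ‖a‖ ≤ 1) (hb : ‖b‖ ≤ 1) :
    eLpNorm (newtonNearPotential r₀ r₁ fun x => ψ x * fderiv ℝ (fun y => fderiv ℝ f y b) x a)
        p volume ≤ 4 * (C * ENNReal.ofReal M * eLpNorm f p (volume.restrict K)) := by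
  have hψ2 : ContDiff ℝ 2 ψ := hψ.of_le (by norm_cast)
  have hf2 : ContDiff ℝ 2 f := hf.of_le (by norm_cast)
  have hψa : ContDiff ℝ ∞ fun y => fderiv ℝ ψ y a := contDiff_pd hψ a
  have hψb : ContDiff ℝ ∞ fun y => fderiv ℝ ψ y b := contDiff_pd hψ b
  have hψba : ContDiff ℝ ∞ fun x => fderiv ℝ (fun y => fderiv ℝ ψ y b) x a := contDiff_pd hψb a
  set G1 : (EuclideanSpace ℝ (Fin 3)) → ℝ := fun x => fderiv ℝ (fun y => fderiv ℝ (fun z => ψ z * f z) y b) x a with hG1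
  set G2 : (EuclideanSpace ℝ (Fin 3)) → ℝ := fun x => fderiv ℝ (fun y => f y * fderiv ℝ ψ y b) x a with hG2
  set G3 : (EuclideanSpace ℝ (Fin 3)) → ℝ := fun x => fderiv ℝ (fun y => f y * fderiv ℝ ψ y a) x b with hG3
  set G4 : (EuclideanSpace ℝ (Fin 3)) → ℝ := fun x => f x * fderiv ℝ (fun y => fderiv ℝ ψ y b) x a with hG4
  have hG1c : Continuous G1 := (contDiff_pd (contDiff_pd (hψ.mul hf) b) a).continuous
  have hG2c : Continuous G2 := (contDiff_pd (hf.mul hψb) a).continuous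
  have hG3c : Continuous G3 := (contDiff_pd (hf.mul hψa) b).continuous
  have hG4c : Continuous G4 := hf.continuous.mul hψba.continuous
  have hsplit : ∀ x, ψ x * fderiv ℝ (fun y => fderiv ℝ f y b) x a = G1 x - G2 x - G3 x + G4 x :=
    fun x => mul_pd_pd_eq hψ2 hf2 x a b
  -- linearity of `N`
  set N := newtonNearPotential r₀ r₁ with hN
  have hlin : N (fun x => ψ x * fderiv ℝ (fun y => fderiv ℝ f y b) x a) =
      fun x => (N G1 x - N G2 x - N G3 x) + N G4 x := by
    funext x
    simp only [hN, newtonNearPotential_apply]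
    have i1 := integrable_newtonNear_mul_comp_sub h₀.le h₁ hG1c x
    have i2 := integrable_newtonNear_mul_comp_sub h₀.le h₁ hG2c x
    have i3 := integrable_newtonNear_mul_comp_sub h₀.le h₁ hG3c x
    have i4 := integrable_newtonNear_mul_comp_sub h₀.le h₁ hG4c x
    have i12 : Integrable (fun z => newtonNear r₀ r₁ z * G1 (x - z) - newtonNear r₀ r₁ z * G2 (x - z)) :=
      i1.sub i2
    have i123 : Integrable (fun z => (newtonNear r₀ r₁ z * G1 (x - z) - newtonNear r₀ r₁ z * G2 (x - z)) -
        newtonNear r₀ r₁ z * G3 (x - z)) := i12.sub i3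
    rw [← integral_sub i1 i2, ← integral_sub i12 i3, ← integral_add i123 i4]
    refine integral_congr_ae (Eventually.of_forall fun z => ?_)
    simp only [hsplit]
    ring
  rw [hlin]
  have hmN : ∀ {G : (EuclideanSpace ℝ (Fin 3)) → ℝ}, Continuous G → AEStronglyMeasurable (N G) volume := fun hG =>
    (contDiff_newtonNearPotential h₀.le h₁ 0 (contDiff_zero.2 hG)).continuous.aestronglyMeasurable
  have hB1 : eLpNorm (N G1) p volume ≤ C * ENNReal.ofReal M * eLpNorm f p (volume.restrict K) := by
    refine (hN2 _ ((hψ.mul hf).of_le (by norm_cast)) hψc.mul_right b a hb ha).trans ?_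
    rw [mul_assoc]
    gcongr
    exact eLpNorm_mul_le_of_abs_le_of_support hK hM0
      (fun x hx => image_eq_zero_of_notMem_tsupport fun h => hx (hψK h)) f p
  have hB2 : eLpNorm (N G2) p volume ≤ C * ENNReal.ofReal M * eLpNorm f p (volume.restrict K) := by
    refine (hN1 _ ((hf.mul hψb).of_le (by norm_cast)) ?_ a ha).trans ?_
    · exact (hasCompactSupport_pd hψc b).mul_left
    rw [mul_assoc]
    gcongr
    rw [show (fun y => f y * fderiv ℝ ψ y b) = fun y => fderiv ℝ ψ y b * f y from
      funext fun y => mul_comm _ _]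
    exact eLpNorm_mul_le_of_abs_le_of_support hK (abs_pd_le hM1 hb)
      (fun x hx => pd_eq_zero_of_notMem_tsupport (fun h => hx (hψK h)) b) f p
  have hB3 : eLpNorm (N G3) p volume ≤ C * ENNReal.ofReal M * eLpNorm f p (volume.restrict K) := by
    refine (hN1 _ ((hf.mul hψa).of_le (by norm_cast)) ?_ b hb).trans ?_
    · exact (hasCompactSupport_pd hψc a).mul_left
    rw [mul_assoc]
    gcongr
    rw [show (fun y => f y * fderiv ℝ ψ y a) = fun y => fderiv ℝ ψ y a * f y from
      funext fun y => mul_comm _ _]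
    exact eLpNorm_mul_le_of_abs_le_of_support hK (abs_pd_le hM1 ha)
      (fun x hx => pd_eq_zero_of_notMem_tsupport (fun h => hx (hψK h)) a) f p
  have hB4 : eLpNorm (N G4) p volume ≤ C * ENNReal.ofReal M * eLpNorm f p (volume.restrict K) := by
    refine (hN0 _ hG4c.aestronglyMeasurable).trans ?_
    rw [mul_assoc]
    gcongr
    rw [show G4 = fun y => fderiv ℝ (fun y => fderiv ℝ ψ y b) y a * f y from
      funext fun y => mul_comm _ _]
    exact eLpNorm_mul_le_of_abs_le_of_support hK (abs_pd_pd_le hψ2 hM2 ha hb)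
      (fun x hx => pd_pd_eq_zero_of_notMem_tsupport (fun h => hx (hψK h)) a b) f p
  calc eLpNorm (fun x => (N G1 x - N G2 x - N G3 x) + N G4 x) p volume
      ≤ eLpNorm (fun x => N G1 x - N G2 x - N G3 x) p volume + eLpNorm (N G4) p volume :=
        eLpNorm_add_le (((hmN hG1c).sub (hmN hG2c)).sub (hmN hG3c)) (hmN hG4c) hp
    _ ≤ (eLpNorm (fun x => N G1 x - N G2 x) p volume + eLpNorm (N G3) p volume) +
          eLpNorm (N G4) p volume := by
        gcongr
        exact eLpNorm_sub_le ((hmN hG1c).sub (hmN hG2c)) (hmN hG3c) hp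
    _ ≤ ((eLpNorm (N G1) p volume + eLpNorm (N G2) p volume) + eLpNorm (N G3) p volume) +
          eLpNorm (N G4) p volume := by
        gcongr
        exact eLpNorm_sub_le (hmN hG1c) (hmN hG2c) hp
    _ ≤ ((C * ENNReal.ofReal M * eLpNorm f p (volume.restrict K) +
          C * ENNReal.ofReal M * eLpNorm f p (volume.restrict K)) +
          C * ENNReal.ofReal M * eLpNorm f p (volume.restrict K)) +
          C * ENNReal.ofReal M * eLpNorm f p (volume.restrict K) := by
        gcongr
    _ = 4 * (C * ENNReal.ofReal M * eLpNorm f p (volume.restrict K)) := by ring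

/-- Integrability of the integrand of `Λ[g](x)` for a continuous density. [folklore] -/
theorem integrable_newtonFarLaplacian_mul_comp_sub (h₀ : 0 < r₀) (h₁ : r₀ < r₁) {g : (EuclideanSpace ℝ (Fin 3)) → ℝ}
    (hg : Continuous g) (x : (EuclideanSpace ℝ (Fin 3))) : Integrable fun z => newtonFarLaplacian r₀ r₁ z * g (x - z) := by
  have h := integrable_smul_comp_sub (integrable_newtonFarLaplacian h₀ h₁)
    (newtonFarLaplacian_eq_zero_of_lt' h₀.le h₁) hg x
  simpa only [smul_eq_mul] using h

/-- **(L0) `‖Λ[ψf]‖_p ≤ C M ‖f‖_{L^p(K)}`.** [folklore] -/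
theorem eLpNorm_newtonFarSmoothing_mul_le
    (hΛ0 : ∀ g : (EuclideanSpace ℝ (Fin 3)) → ℝ, AEStronglyMeasurable g volume →
      eLpNorm (newtonFarSmoothing r₀ r₁ g) p volume ≤ C * eLpNorm g p volume)
    (hK : MeasurableSet K) (hψK : tsupport ψ ⊆ K) (hM0 : ∀ x, |ψ x| ≤ M)
    (hψm : Continuous ψ) (hf : Continuous f) :
    eLpNorm (newtonFarSmoothing r₀ r₁ fun x => ψ x * f x) p volume ≤
      C * ENNReal.ofReal M * eLpNorm f p (volume.restrict K) := by
  refine (hΛ0 _ (hψm.mul hf).aestronglyMeasurable).trans ?_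
  rw [mul_assoc]
  gcongr
  exact eLpNorm_mul_le_of_abs_le_of_support hK hM0
    (fun x hx => image_eq_zero_of_notMem_tsupport fun h => hx (hψK h)) f p

/-- **(L1) `‖Λ[ψ ∂ₐf]‖_p ≤ 2 C M ‖f‖_{L^p(K)}`** (`Λ[∂ₐ(ψf)] = (∂ₐλ) ⋆ (ψf)`). [folklore] -/
theorem eLpNorm_newtonFarSmoothing_mul_pd_le (h₀ : 0 < r₀) (h₁ : r₀ < r₁) (hp : 1 ≤ p)
    (hΛ0 : ∀ g : (EuclideanSpace ℝ (Fin 3)) → ℝ, AEStronglyMeasurable g volume →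
      eLpNorm (newtonFarSmoothing r₀ r₁ g) p volume ≤ C * eLpNorm g p volume)
    (hΛ1 : ∀ g : (EuclideanSpace ℝ (Fin 3)) → ℝ, AEStronglyMeasurable g volume → ∀ c : (EuclideanSpace ℝ (Fin 3)), ‖c‖ ≤ 1 →
      eLpNorm (fun x => ∫ z, fderiv ℝ (newtonFarLaplacian r₀ r₁) z c * g (x - z)) p volume ≤
        C * eLpNorm g p volume)
    (hψ : ContDiff ℝ ∞ ψ) (hK : MeasurableSet K) (hψK : tsupport ψ ⊆ K)
    (hM0 : ∀ x, |ψ x| ≤ M) (hM1 : ∀ x, ‖fderiv ℝ ψ x‖ ≤ M) (hf : ContDiff ℝ ∞ f)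
    {a : (EuclideanSpace ℝ (Fin 3))} (ha : ‖a‖ ≤ 1) :
    eLpNorm (newtonFarSmoothing r₀ r₁ fun x => ψ x * fderiv ℝ f x a) p volume ≤
      2 * (C * ENNReal.ofReal M * eLpNorm f p (volume.restrict K)) := by
  have hψ1 : ContDiff ℝ 1 ψ := hψ.of_le (by norm_cast)
  have hf1 : ContDiff ℝ 1 f := hf.of_le (by norm_cast)
  have hψa : ContDiff ℝ ∞ fun y => fderiv ℝ ψ y a := contDiff_pd hψ a
  set G1 : (EuclideanSpace ℝ (Fin 3)) → ℝ := fun x => fderiv ℝ (fun y => ψ y * f y) x a with hG1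
  set G2 : (EuclideanSpace ℝ (Fin 3)) → ℝ := fun x => fderiv ℝ ψ x a * f x with hG2
  have hG1c : Continuous G1 := (contDiff_pd (hψ.mul hf) a).continuous
  have hG2c : Continuous G2 := hψa.continuous.mul hf.continuous
  have hsplit : ∀ x, ψ x * fderiv ℝ f x a = G1 x - G2 x := fun x => by
    rw [mul_pd_eq hψ1 hf1 x a, hG2]; ring
  set Λ := newtonFarSmoothing r₀ r₁ with hΛ
  have hlin : Λ (fun x => ψ x * fderiv ℝ f x a) = fun x => Λ G1 x - Λ G2 x := by
    funext x
    simp only [hΛ, newtonFarSmoothing_apply]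
    rw [← integral_sub (integrable_newtonFarLaplacian_mul_comp_sub h₀ h₁ hG1c x)
      (integrable_newtonFarLaplacian_mul_comp_sub h₀ h₁ hG2c x)]
    refine integral_congr_ae (Eventually.of_forall fun z => ?_)
    simp only [hsplit]
    ring
  rw [hlin]
  have hm1 : AEStronglyMeasurable (Λ G1) volume :=
    (continuous_newtonFarSmoothing h₀ h₁ hG1c).aestronglyMeasurable
  have hm2 : AEStronglyMeasurable (Λ G2) volume :=
    (continuous_newtonFarSmoothing h₀ h₁ hG2c).aestronglyMeasurable
  refine (eLpNorm_sub_le hm1 hm2 hp).trans ?_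
  rw [two_mul]
  refine add_le_add ?_ ?_
  · have e : Λ G1 = fun x => ∫ z, fderiv ℝ (newtonFarLaplacian r₀ r₁) z a * (ψ (x - z) * f (x - z)) := by
      funext x
      exact newtonFarSmoothing_pd_eq h₀ h₁ ((hψ.mul hf).of_le (by norm_cast)) x a
    rw [e]
    refine (hΛ1 (fun x => ψ x * f x) (hψ.continuous.mul hf.continuous).aestronglyMeasurable a ha).trans ?_
    rw [mul_assoc]
    gcongr
    exact eLpNorm_mul_le_of_abs_le_of_support hK hM0
      (fun x hx => image_eq_zero_of_notMem_tsupport fun h => hx (hψK h)) f p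
  · refine (hΛ0 _ hG2c.aestronglyMeasurable).trans ?_
    rw [mul_assoc]
    gcongr
    exact eLpNorm_mul_le_of_abs_le_of_support hK (abs_pd_le hM1 ha)
      (fun x hx => pd_eq_zero_of_notMem_tsupport (fun h => hx (hψK h)) a) f p

end Move

/-! ### §6. Subadditivity of `g ↦ ‖N[g]‖_p`, `g ↦ ‖Λ[g]‖_p` -/

section Linear

variable {r₀ r₁ : ℝ} {p : ℝ≥0∞} {f g : (EuclideanSpace ℝ (Fin 3)) → ℝ}

/-- `N[g]` is continuous for a continuous density. [folklore] -/
theorem continuous_newtonNearPotential (h₀ : 0 ≤ r₀) (h₁ : r₀ < r₁) (hg : Continuous g) :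
    Continuous (newtonNearPotential r₀ r₁ g) :=
  (contDiff_newtonNearPotential h₀ h₁ 0 (contDiff_zero.2 hg)).continuous

/-- `‖N[f + g]‖_p ≤ ‖N[f]‖_p + ‖N[g]‖_p`. [folklore] -/
theorem eLpNorm_newtonNearPotential_add_le (h₀ : 0 ≤ r₀) (h₁ : r₀ < r₁) (hp : 1 ≤ p)
    (hf : Continuous f) (hg : Continuous g) :
    eLpNorm (newtonNearPotential r₀ r₁ fun x => f x + g x) p volume ≤
      eLpNorm (newtonNearPotential r₀ r₁ f) p volume + eLpNorm (newtonNearPotential r₀ r₁ g) p volume := by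
  have h : (newtonNearPotential r₀ r₁ fun x => f x + g x) =
      fun x => newtonNearPotential r₀ r₁ f x + newtonNearPotential r₀ r₁ g x :=
    funext fun x => newtonNearPotential_add h₀ h₁ hf hg x
  rw [h]
  exact eLpNorm_add_le (continuous_newtonNearPotential h₀ h₁ hf).aestronglyMeasurable
    (continuous_newtonNearPotential h₀ h₁ hg).aestronglyMeasurable hp

/-- `‖N[a f]‖_p = |a| ‖N[f]‖_p`. [folklore] -/
theorem eLpNorm_newtonNearPotential_const_mul (a : ℝ) (f : (EuclideanSpace ℝ (Fin 3)) → ℝ) :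
    eLpNorm (newtonNearPotential r₀ r₁ fun x => a * f x) p volume =
      ‖a‖ₑ * eLpNorm (newtonNearPotential r₀ r₁ f) p volume := by
  have h : (newtonNearPotential r₀ r₁ fun x => a * f x) = a • newtonNearPotential r₀ r₁ f :=
    funext fun x => newtonNearPotential_const_mul r₀ r₁ a f x
  rw [h, eLpNorm_const_smul]

/-- `‖N[f − g]‖_p ≤ ‖N[f]‖_p + ‖N[g]‖_p`. [folklore] -/
theorem eLpNorm_newtonNearPotential_sub_le (h₀ : 0 ≤ r₀) (h₁ : r₀ < r₁) (hp : 1 ≤ p)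
    (hf : Continuous f) (hg : Continuous g) :
    eLpNorm (newtonNearPotential r₀ r₁ fun x => f x - g x) p volume ≤
      eLpNorm (newtonNearPotential r₀ r₁ f) p volume + eLpNorm (newtonNearPotential r₀ r₁ g) p volume := by
  have h : (fun x => f x - g x) = fun x => f x + (-1) * g x := funext fun x => by ring
  rw [h]
  have hg' : Continuous fun x => (-1 : ℝ) * g x := continuous_const.mul hg
  refine (eLpNorm_newtonNearPotential_add_le h₀ h₁ hp hf hg').trans ?_
  rw [eLpNorm_newtonNearPotential_const_mul]
  simp

/-- `‖N[Σₗ (fₗ − gₗ)]‖_p ≤ Σₗ (‖N[fₗ]‖_p + ‖N[gₗ]‖_p)`. [folklore] -/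
theorem eLpNorm_newtonNearPotential_sum_sub_le (h₀ : 0 ≤ r₀) (h₁ : r₀ < r₁) (hp : 1 ≤ p)
    {ι : Type*} (s : Finset ι) {F G : ι → (EuclideanSpace ℝ (Fin 3)) → ℝ} (hF : ∀ l, Continuous (F l))
    (hG : ∀ l, Continuous (G l)) :
    eLpNorm (newtonNearPotential r₀ r₁ fun x => ∑ l ∈ s, (F l x - G l x)) p volume ≤
      ∑ l ∈ s, (eLpNorm (newtonNearPotential r₀ r₁ (F l)) p volume +
        eLpNorm (newtonNearPotential r₀ r₁ (G l)) p volume) := by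
  classical
  induction s using Finset.induction_on with
  | empty =>
    simp only [Finset.sum_empty]
    have h0 : (newtonNearPotential r₀ r₁ fun _ : (EuclideanSpace ℝ (Fin 3)) => (0 : ℝ)) = 0 := by
      funext x; simp [newtonNearPotential_apply]
    rw [h0, eLpNorm_zero]
  | insert a s ha ih =>
    simp only [Finset.sum_insert ha]
    have hrest : Continuous fun x => ∑ l ∈ s, (F l x - G l x) :=
      continuous_finsetSum s fun l _ => (hF l).sub (hG l)
    refine (eLpNorm_newtonNearPotential_add_le h₀ h₁ hp ((hF a).sub (hG a)) hrest).trans ?_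
    exact add_le_add (eLpNorm_newtonNearPotential_sub_le h₀ h₁ hp (hF a) (hG a)) ih

/-- `‖Λ[f − g]‖_p ≤ ‖Λ[f]‖_p + ‖Λ[g]‖_p`. [folklore] -/
theorem eLpNorm_newtonFarSmoothing_sub_le (h₀ : 0 < r₀) (h₁ : r₀ < r₁) (hp : 1 ≤ p)
    (hf : Continuous f) (hg : Continuous g) :
    eLpNorm (newtonFarSmoothing r₀ r₁ fun x => f x - g x) p volume ≤
      eLpNorm (newtonFarSmoothing r₀ r₁ f) p volume + eLpNorm (newtonFarSmoothing r₀ r₁ g) p volume := by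
  have h : (newtonFarSmoothing r₀ r₁ fun x => f x - g x) =
      fun x => newtonFarSmoothing r₀ r₁ f x - newtonFarSmoothing r₀ r₁ g x := by
    funext x
    simp only [newtonFarSmoothing_apply]
    rw [← integral_sub (integrable_newtonFarLaplacian_mul_comp_sub h₀ h₁ hf x)
      (integrable_newtonFarLaplacian_mul_comp_sub h₀ h₁ hg x)]
    exact integral_congr_ae (Eventually.of_forall fun z => by ring)
  rw [h]
  exact eLpNorm_sub_le (continuous_newtonFarSmoothing h₀ h₁ hf).aestronglyMeasurable
    (continuous_newtonFarSmoothing h₀ h₁ hg).aestronglyMeasurable hp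

end Linear

end Tsai2021

end Literature.Analysis.FluidPDE

end
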